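/-
Copyright: statement-level skeleton of a published paper (lit-balaban cell, Phase-2 proof seat p25, gen 21). No proof
claims beyond what the kernel checks below.
-/
import Literature.MathematicalPhysics.QuantumFieldTheory.BalabanImbrieJaffe1984to88.BIJ88WalkWeights312

/-!
# `BalabanImbrieJaffe1984to88.BIJ88WalkWeightsN312` — T. Bałaban, J. Imbrie, A. Jaffe, *Effective action and cluster
properties of the abelian Higgs model*, Commun. Math. Phys. **114** (1988) 257–315 [BalabanImbrieJaffe1988], §5.14
p. 312 [PDF 56], verbatim (x2 render `lit-balaban-r16/renders/cmp114/original-p056-x2.png`): *"The main source of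
concern in estimating G_k(X_{r′}) is that we only have bounds |F_{k,loc}(X_{σ_1})| ≦ c(L^kε)^{−m(c)}e^{−m′(c)}, coming
from our estimates on perturbation expansions of observables … By performing sufficiently many integrations by parts,
we have arranged for enough small factors to beat these large factors in the remainder terms"* — **THE WEIGHT
INVARIANT OF `BIJ88WalkWeights312` IN AN ABSTRACT CURRENCY FOR THE `χ′`-DIRECTIONS** (p25 gen 21; a MEMBER-LEVEL
GENERALIZATION of row C2.Claim@312, owner r16 ruling 2026-08-23T11:27:10Z: new files only, the head of record
`BIJ88WalkIneq312RemainderBdry.ineq312_remainder_bdry` (r16 v2.284, ref-5 g68) UNCHANGED and later RE-DERIVED as the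
instance `N = ‖·‖_∞`).

Gen 18's weight invariant books each `χ′`-direction `z = C_p u` through its sup norm `‖z‖` against the hypothesis
`‖C_p u‖ ≤ B p`.  Print's p. 312 estimate is currency-agnostic: the only two places where the size of a direction is
USED are (i) this booking step and (ii) the analytic step `|(Π_{z∈D}∂_z)χ| ≤ K·Π_z(η_χ·size z)` (gen 19's
`BIJ88WalkRemainderExpectation312`).  Here (i) is re-proved for an ARBITRARY size functional
`N : (S → ℝ) → ℝ`, `N ≥ 0`, under `N(C_p u) ≤ B p` (`u ∈ Dir`): for every outcome `o` of a run,
`|a_o|·Π_{z ∈ D_o} N(z) · wt g · Π_{h∈done} wt h ≤ wt o.g · Π_{h∈o.done} wt h` (`run_weight_N`), hence for every term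
`|coef_t|·Π_{z∈dirs_t} N(z) ≤ Π_{X ∈ blocks} wt X · Π_{X ∈ remainder components} wt X` (`expand_weight_N`,
`expand_weight_init_N`).  The case `N = ‖·‖_∞` is gen 18's `BIJ88WalkWeights312.expand_weight_init`; the case
`N(z) = Σ_b|ℓ_b(z)|` (the seminorm seen by a product cutoff `Π_b χ₁(ℓ_b Φ/p)`) is the VOLUME-FREE currency of
`BIJ88WalkProductCutoffVolFree312` (this generation), whose booking input is an `ℓ¹→ℓ¹` operator-norm bound on the
covariance pieces.

statement-level skeleton of published theorems with citation tags; proofs where landed; nothing here is a claim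
about the Yang–Mills mass gap

PDF held: `paper:balaban1988-cmp114-bij-abelian-higgs-effective-action` (journal page = PDF page + 256); p. 311–312 =
PDF 55–56 (`p0055.txt` L23–38, `p0056.txt` L1–31; x2 render of p. 312 re-read 2026-08-23).

CITATION HEADER (lean-in-tree rule).  lit-balaban cell (HOME `run/shared/lean/pub/lit-balaban/`), Phase 2, seat p25
gen 21; row **C2.Claim@312** of `HOME/lit-balaban-r16/ROWS-C2-part2.md` (owner r16, referee ref-5; head theorem of
record UNCHANGED; this file is a MEMBER — currency generalized to a size functional `N`).  USED BY NAME, nothing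
restated: `BIJ88WalkRun311.{WGrp, WOut, run, pristine, WGrp.absorb, WOut.scale/push/bump}`,
`BIJ88WalkRunEnv311.{run_ind', run_rest_subset, run_done_le}`, `BIJ88WalkExpansion311.{WTerm, oact, expand,
expand_of_nonempty, expand_of_not_nonempty}`, `BIJ88WalkWeights312.{wt, run_pend_dir}` (p25 gen 18),
`BIJ88LabelledRun311.mem_mbind`.

## What is proved (0 `sorry`, standard axioms, no new `Prop` facts; theorems only, no definitions)

* **`run_weight_N`** (THE WEIGHT INVARIANT ALONG A RUN in the currency `N`), **`expand_weight_N`** /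
  **`expand_weight_init_N`** (for a term: `|coef|·Π_{dirs} N ≤ Π_{blocks} wt · Π_{remainder components} wt`),
  `expand_weight_init_norm` (gen 18's statement re-derived as the instance `N = ‖·‖_∞`, consistency check).
HONEST SCOPE: (a) bookkeeping inequalities only: `B p`, `cV m` are free nonnegative data; (b) `N` is ANY nonnegative
functional — no triangle inequality or homogeneity is used by the booking (only `N(C_p u) ≤ B p` on `Dir`); (c) the
number of terms is not counted here (`BIJ88WalkLocalTermCount312`, currency-free); (d) contraction-graph components,
fixed order of events, as in gen 18.  NOT summit progress; NOT continuum; NOT Clay.  Imports `BIJ88WalkWeights312`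
only; modifies nothing.
-/

noncomputable section

namespace Literature.MathematicalPhysics.QuantumFieldTheory.BalabanImbrieJaffe1984to88.BIJ88WalkWeightsN312

open Classical Matrix Finset
open scoped BigOperators
open BIJ88LabelledRun311 (mbind mem_mbind)
open BIJ88WalkRun311 BIJ88WalkRunEnv311 BIJ88WalkExpansion311 BIJ88WalkWeights312

variable {S : Type} [Fintype S] {ι : Type} [Fintype ι] {κ : Type} [LinearOrder κ] {P : Type} [Fintype P]

section Run

variable {Cov : P → Matrix S S ℝ} {trig : P → Bool} {f : S → ℝ} {c : ι → ℝ} {legs : ι → List (S → ℝ)}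
  {obs : κ → List (S → ℝ)} {M : ℕ}

/-! ## §1  Bookkeeping for the weights and for the size in the currency `N` -/

omit [Fintype S] [Fintype ι] [LinearOrder κ] [Fintype P] in
/-- Weights are nonnegative for nonnegative bounds (bookkeeping). [folklore] -/
private theorem wt_nonneg' {B : P → ℝ} {cV : ι → ℝ} (hB : ∀ p, 0 ≤ B p) (hcV : ∀ m, 0 ≤ cV m) (g : WGrp S κ ι P) :
    0 ≤ wt B cV g :=
  mul_nonneg (Multiset.prod_nonneg fun x hx => by
      obtain ⟨p, -, rfl⟩ := Multiset.mem_map.1 hx; exact hB p)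
    (Multiset.prod_nonneg fun x hx => by obtain ⟨m, -, rfl⟩ := Multiset.mem_map.1 hx; exact hcV m)

omit [Fintype S] [Fintype ι] [LinearOrder κ] [Fintype P] in
/-- Products of weights are nonnegative (bookkeeping). [folklore] -/
private theorem prod_wt_nonneg' {B : P → ℝ} {cV : ι → ℝ} (hB : ∀ p, 0 ≤ B p) (hcV : ∀ m, 0 ≤ cV m)
    (done : Multiset (WGrp S κ ι P)) : 0 ≤ (done.map (wt B cV)).prod :=
  Multiset.prod_nonneg fun x hx => by obtain ⟨h, -, rfl⟩ := Multiset.mem_map.1 hx; exact wt_nonneg' hB hcV h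

omit [Fintype S] [Fintype ι] [LinearOrder κ] [Fintype P] in
/-- The size of an outcome in the currency `N`, `|a|·Π_{z∈D} N z`, is nonnegative for `N ≥ 0` (bookkeeping). [folklore] -/
private theorem sizeN_nonneg {N : (S → ℝ) → ℝ} (hN0 : ∀ z, 0 ≤ N z) (o : WOut S κ ι P) :
    0 ≤ |o.a| * (o.D.map N).prod :=
  mul_nonneg (abs_nonneg _) (List.prod_nonneg fun x hx => by
    obtain ⟨z, -, rfl⟩ := List.mem_map.1 hx; exact hN0 z)

omit [Fintype S] [Fintype ι] [LinearOrder κ] [Fintype P] in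
/-- Recording a piece multiplies the weight by its bound (bookkeeping). [folklore] -/
private theorem wt_rec' (B : P → ℝ) (cV : ι → ℝ) (g : WGrp S κ ι P) (L : List (S → ℝ)) (n nw : ℕ) (p : P) :
    wt B cV (⟨L, n, g.vxs, g.lab, p ::ₘ g.pcs, nw⟩ : WGrp S κ ι P) = B p * wt B cV g := by
  simp only [wt, Multiset.map_cons, Multiset.prod_cons, mul_assoc]

omit [Fintype S] [Fintype ι] [LinearOrder κ] [Fintype P] in
/-- Recording a piece and a label (bookkeeping). [folklore] -/
private theorem wt_lab' (B : P → ℝ) (cV : ι → ℝ) (g : WGrp S κ ι P) (L : List (S → ℝ)) (n nw : ℕ) (lab : Finset κ)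
    (p : P) : wt B cV (⟨L, n, g.vxs, lab, p ::ₘ g.pcs, nw⟩ : WGrp S κ ι P) = B p * wt B cV g := by
  simp only [wt, Multiset.map_cons, Multiset.prod_cons, mul_assoc]

omit [Fintype S] [Fintype ι] [LinearOrder κ] [Fintype P] in
/-- Recording a piece and a vertex (bookkeeping). [folklore] -/
private theorem wt_vx' (B : P → ℝ) (cV : ι → ℝ) (g : WGrp S κ ι P) (L : List (S → ℝ)) (n nw : ℕ) (m : ι) (p : P) :
    wt B cV (⟨L, n, m ::ₘ g.vxs, g.lab, p ::ₘ g.pcs, nw⟩ : WGrp S κ ι P) = B p * cV m * wt B cV g := by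
  simp only [wt, Multiset.map_cons, Multiset.prod_cons]; ring

omit [Fintype S] [Fintype ι] [Fintype P] in
/-- Absorbing a component multiplies the weights (bookkeeping). [folklore] -/
private theorem wt_absorb' (B : P → ℝ) (cV : ι → ℝ) (L : List (S → ℝ)) (g h : WGrp S κ ι P) (i : ℕ) (p : P) :
    wt B cV (WGrp.absorb trig L g h i p) = B p * wt B cV g * wt B cV h := by
  simp only [wt, WGrp.absorb, Multiset.map_cons, Multiset.prod_cons, Multiset.map_add, Multiset.prod_add]; ring

omit [Fintype S] in
/-- A positional leg is a leg, or the default `0` (bookkeeping). [folklore] -/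
private theorem getD_mem_or' (L : List (S → ℝ)) (i : ℕ) : L.getD i 0 ∈ L ∨ L.getD i 0 = 0 := by
  by_cases hi : i < L.length
  · rw [List.getD_eq_getElem L 0 hi]; exact Or.inl (List.getElem_mem hi)
  · exact Or.inr (List.getD_eq_default L 0 (not_lt.1 hi))

omit [Fintype S] [Fintype ι] [LinearOrder κ] [Fintype P] in
/-- One multiplicative step of the invariant (bookkeeping): `b ≤ Bp`, `T·(Bp·W) ≤ E` ⇒ `b·T·W ≤ E` for `T, W ≥ 0`.
[folklore] -/
private theorem step' {b Bp T W E : ℝ} (hb : b ≤ Bp) (hT : 0 ≤ T) (hW : 0 ≤ W)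
    (h : T * (Bp * W) ≤ E) : b * T * W ≤ E :=
  le_trans (by nlinarith [mul_nonneg hT hW]) h

omit [Fintype S] [Fintype ι] [LinearOrder κ] [Fintype P] in
/-- Size of a scaled outcome (bookkeeping). [folklore] -/
private theorem sizeN_scale (N : (S → ℝ) → ℝ) (p : P) (b : ℝ) (o : WOut S κ ι P) :
    |(o.scale p b).a| * ((o.scale p b).D.map N).prod = |b| * (|o.a| * (o.D.map N).prod) := by
  simp only [WOut.scale_a, WOut.scale_D, abs_mul, mul_assoc]

omit [Fintype S] [Fintype ι] [LinearOrder κ] [Fintype P] in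
/-- Size of an outcome with one more direction (bookkeeping). [folklore] -/
private theorem sizeN_push (N : (S → ℝ) → ℝ) (p : P) (z : S → ℝ) (o : WOut S κ ι P) :
    |(o.push p z).a| * ((o.push p z).D.map N).prod = N z * (|o.a| * (o.D.map N).prod) := by
  simp only [WOut.push_a, WOut.push_D, List.map_cons, List.prod_cons]; ring

omit [Fintype S] [Fintype ι] [LinearOrder κ] [Fintype P] in
/-- Size of a scaled outcome with a vertex recorded (bookkeeping). [folklore] -/
private theorem sizeN_scale_bump (N : (S → ℝ) → ℝ) (p : P) (b : ℝ) (o : WOut S κ ι P) :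
    |((o.scale p b).bump).a| * (((o.scale p b).bump).D.map N).prod = |b| * (|o.a| * (o.D.map N).prod) := by
  simp only [WOut.bump_a, WOut.bump_D, WOut.scale_a, WOut.scale_D, abs_mul, mul_assoc]

/-! ## §2  The weight invariant along a run, in the currency `N` -/

/-- **THE WEIGHT INVARIANT ALONG A RUN IN AN ABSTRACT CURRENCY `N` FOR THE `χ′`-DIRECTIONS** (p. 312: large factors
per contraction, small factors per vertex and per random-walk piece, booked where they occur): legs in a direction set
`Dir` (observables' and vertices' legs in `Dir`), brackets of the piece `p` between legs of `Dir` and to the source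
bounded by `B p ≥ 0`, `N(Cov p u) ≤ B p` on `Dir` for a size functional `N ≥ 0`, couplings `|c m| ≤ cV m`.  Then for
every outcome `o` of `run g rest done`:
`|a_o|·Π_{z∈D_o} N z · wt g · Π_{h ∈ done} wt h ≤ wt o.g · Π_{h ∈ o.done} wt h`.  (`N = ‖·‖_∞`:
`BIJ88WalkWeights312.run_weight`.) [cite: BalabanImbrieJaffe1988, §5.14 p.312] -/
theorem run_weight_N {N : (S → ℝ) → ℝ} (hN0 : ∀ z, 0 ≤ N z) {Dir : Set (S → ℝ)} {B : P → ℝ} {cV : ι → ℝ}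
    (hB0 : ∀ p, 0 ≤ B p) (hcV0 : ∀ m, 0 ≤ cV m)
    (hB : ∀ p, ∀ u ∈ Dir, ∀ w ∈ Dir, |(Cov p *ᵥ u) ⬝ᵥ w| ≤ B p) (hBf : ∀ p, ∀ u ∈ Dir, |(Cov p *ᵥ u) ⬝ᵥ f| ≤ B p)
    (hBzN : ∀ p, ∀ u ∈ Dir, N (Cov p *ᵥ u) ≤ B p) (hcV : ∀ m, |c m| ≤ cV m)
    (hobs : ∀ j, ∀ w ∈ obs j, w ∈ Dir) (hlegs : ∀ m, ∀ w ∈ legs m, w ∈ Dir)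
    (g : WGrp S κ ι P) (rest : Finset κ) (done : Multiset (WGrp S κ ι P)) :
    ∀ o ∈ run Cov trig f c legs obs M g rest done, (∀ w ∈ g.pend, w ∈ Dir) → (∀ h ∈ done, ∀ w ∈ h.pend, w ∈ Dir) →
      |o.a| * (o.D.map N).prod * (wt B cV g * (done.map (wt B cV)).prod)
        ≤ wt B cV o.g * (o.done.map (wt B cV)).prod := by
  have hgetD : ∀ p, ∀ u ∈ Dir, ∀ L : List (S → ℝ), (∀ w ∈ L, w ∈ Dir) → ∀ i, |(Cov p *ᵥ u) ⬝ᵥ L.getD i 0| ≤ B p :=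
    fun p u hu L hL i => by
      rcases getD_mem_or' L i with h | h
      · exact hB p u hu _ (hL _ h)
      · rw [h, dotProduct_zero, abs_zero]; exact hB0 p
  have hW : ∀ (g : WGrp S κ ι P) (done : Multiset (WGrp S κ ι P)), 0 ≤ wt B cV g * (done.map (wt B cV)).prod :=
    fun g done => mul_nonneg (wt_nonneg' hB0 hcV0 _) (prod_wt_nonneg' hB0 hcV0 _)
  refine run_ind' (Q := fun g _ done o => (∀ w ∈ g.pend, w ∈ Dir) → (∀ h ∈ done, ∀ w ∈ h.pend, w ∈ Dir) →
      |o.a| * (o.D.map N).prod * (wt B cV g * (done.map (wt B cV)).prod) ≤ wt B cV o.g * (o.done.map (wt B cV)).prod)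
    (fun g _ done _ _ _ => by simp) ?_ ?_ ?_ ?_ ?_ ?_ g rest done
  · intro g rest done u L p _ hp i o _ IH hg hd
    have hu : u ∈ Dir := hg u (by rw [hp]; exact List.mem_cons_self)
    have hL : ∀ w ∈ L, w ∈ Dir := fun w hw => hg w (by rw [hp]; exact List.mem_cons_of_mem _ hw)
    have h := IH (fun w hw => hL w (List.mem_of_mem_eraseIdx hw)) hd
    rw [wt_rec', mul_assoc (B p)] at h
    simp only [WOut.scale_g, WOut.scale_done, sizeN_scale]
    exact step' (hgetD p u hu L hL i) (sizeN_nonneg hN0 o) (hW _ _) h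
  · intro g rest done u L p _ hp j _ i o _ IH hg hd
    have hu : u ∈ Dir := hg u (by rw [hp]; exact List.mem_cons_self)
    have hL : ∀ w ∈ L, w ∈ Dir := fun w hw => hg w (by rw [hp]; exact List.mem_cons_of_mem _ hw)
    have h := IH (fun w hw => by
      rcases List.mem_append.1 hw with hw | hw
      · exact hL w hw
      · exact hobs j w (List.mem_of_mem_eraseIdx hw)) hd
    rw [wt_lab', mul_assoc (B p)] at h
    simp only [WOut.scale_g, WOut.scale_done, sizeN_scale]
    exact step' (hgetD p u hu _ (hobs j) i) (sizeN_nonneg hN0 o) (hW _ _) h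
  · intro g rest done u L p _ hp h hh i _ o _ IH hg hd
    have hu : u ∈ Dir := hg u (by rw [hp]; exact List.mem_cons_self)
    have hL : ∀ w ∈ L, w ∈ Dir := fun w hw => hg w (by rw [hp]; exact List.mem_cons_of_mem _ hw)
    have h' := IH (fun w hw => by
      simp only [WGrp.absorb, List.mem_append] at hw
      rcases hw with hw | hw
      · exact hL w hw
      · exact hd h hh w (List.mem_of_mem_eraseIdx hw))
      (fun h' hh' => hd h' (Multiset.mem_of_le (Multiset.erase_le _ _) hh'))
    rw [wt_absorb', mul_assoc (B p * wt B cV g), mul_assoc (B p)] at h'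
    have hprod : (done.map (wt B cV)).prod = wt B cV h * ((done.erase h).map (wt B cV)).prod := by
      conv_lhs => rw [← Multiset.cons_erase hh]
      rw [Multiset.map_cons, Multiset.prod_cons]
    simp only [WOut.scale_g, WOut.scale_done, sizeN_scale]
    rw [hprod]
    exact step' (hgetD p u hu _ (hd h hh) i) (sizeN_nonneg hN0 o)
      (mul_nonneg (wt_nonneg' hB0 hcV0 _) (mul_nonneg (wt_nonneg' hB0 hcV0 _) (prod_wt_nonneg' hB0 hcV0 _))) h'
  · intro g rest done u L p _ hp o _ IH hg hd
    have hu : u ∈ Dir := hg u (by rw [hp]; exact List.mem_cons_self)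
    have hL : ∀ w ∈ L, w ∈ Dir := fun w hw => hg w (by rw [hp]; exact List.mem_cons_of_mem _ hw)
    have h := IH hL hd
    rw [wt_rec', mul_assoc (B p)] at h
    simp only [WOut.scale_g, WOut.scale_done, sizeN_scale]
    exact step' (hBf p u hu) (sizeN_nonneg hN0 o) (hW _ _) h
  · intro g rest done u L p _ hp o _ IH hg hd
    have hu : u ∈ Dir := hg u (by rw [hp]; exact List.mem_cons_self)
    have hL : ∀ w ∈ L, w ∈ Dir := fun w hw => hg w (by rw [hp]; exact List.mem_cons_of_mem _ hw)
    have h := IH hL hd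
    rw [wt_rec', mul_assoc (B p)] at h
    simp only [WOut.push_g, WOut.push_done, sizeN_push]
    have hz : |N (Cov p *ᵥ u)| ≤ B p := by rw [abs_of_nonneg (hN0 _)]; exact hBzN p u hu
    have h2 := step' hz (sizeN_nonneg hN0 o) (hW _ _) h
    rwa [abs_of_nonneg (hN0 _)] at h2
  · intro g rest done u L p _ hp m j o _ IH hg hd
    have hu : u ∈ Dir := hg u (by rw [hp]; exact List.mem_cons_self)
    have hL : ∀ w ∈ L, w ∈ Dir := fun w hw => hg w (by rw [hp]; exact List.mem_cons_of_mem _ hw)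
    have h := IH (fun w hw => by
      rcases List.mem_append.1 hw with hw | hw
      · exact hL w hw
      · exact hlegs m w (List.mem_of_mem_eraseIdx hw)) hd
    rw [wt_vx', mul_assoc (B p * cV m)] at h
    simp only [WOut.bump_g, WOut.bump_done, WOut.scale_g, WOut.scale_done, sizeN_scale_bump]
    have hb : |(-(c m * ((Cov p *ᵥ u) ⬝ᵥ (legs m).getD j 0)))| ≤ B p * cV m := by
      rw [abs_neg, abs_mul, mul_comm (B p)]
      exact mul_le_mul (hcV m) (hgetD p u hu _ (hlegs m) j) (abs_nonneg _) (hcV0 m)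
    exact step' hb (sizeN_nonneg hN0 o) (hW _ _) h

end Run

/-! ## §3  The weight of a term in the currency `N` -/

section Expand

variable {Cov : P → Matrix S S ℝ} {trig : P → Bool} {f : S → ℝ} {c : ι → ℝ} {legs : ι → List (S → ℝ)}
  {obs : κ → List (S → ℝ)} {M : ℕ}

omit [Fintype S] [Fintype ι] [LinearOrder κ] [Fintype P] in
/-- A pristine observable has weight one (bookkeeping). [folklore] -/
private theorem wt_pristine' (B : P → ℝ) (cV : ι → ℝ) (j : κ) : wt B cV (pristine (ι := ι) (P := P) obs j) = 1 := by
  simp [wt, pristine]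

/-- **THE WEIGHT OF A TERM IN THE CURRENCY `N`, COMPONENT BY COMPONENT** (p. 312): under the hypotheses of
`run_weight_N`, for every term `t` of `expand done rest` (set-aside components with legs in `Dir`):
`|coef_t| · Π_{z ∈ dirs_t} N z · Π_{h ∈ done} wt h ≤ Π_{X ∈ t.consts} wt X · Π_{X ∈ t.groups} wt X`.  (`N = ‖·‖_∞`:
`BIJ88WalkWeights312.expand_weight`.) [cite: BalabanImbrieJaffe1988, §5.14 p.312] -/
theorem expand_weight_N {N : (S → ℝ) → ℝ} (hN0 : ∀ z, 0 ≤ N z) {Dir : Set (S → ℝ)} {B : P → ℝ} {cV : ι → ℝ}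
    (hB0 : ∀ p, 0 ≤ B p) (hcV0 : ∀ m, 0 ≤ cV m)
    (hB : ∀ p, ∀ u ∈ Dir, ∀ w ∈ Dir, |(Cov p *ᵥ u) ⬝ᵥ w| ≤ B p) (hBf : ∀ p, ∀ u ∈ Dir, |(Cov p *ᵥ u) ⬝ᵥ f| ≤ B p)
    (hBzN : ∀ p, ∀ u ∈ Dir, N (Cov p *ᵥ u) ≤ B p) (hcV : ∀ m, |c m| ≤ cV m)
    (hobs : ∀ j, ∀ w ∈ obs j, w ∈ Dir) (hlegs : ∀ m, ∀ w ∈ legs m, w ∈ Dir) :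
    ∀ (n : ℕ) (done : Multiset (WGrp S κ ι P)) (rest : Finset κ), rest.card < n →
      (∀ h ∈ done, ∀ w ∈ h.pend, w ∈ Dir) → ∀ t ∈ expand Cov trig f c legs obs M done rest,
        |t.coef| * (t.dirs.map N).prod * (done.map (wt B cV)).prod
          ≤ (t.consts.map (wt B cV)).prod * (t.groups.map (wt B cV)).prod
  | 0, _, _, hn => fun _ _ _ => absurd hn (Nat.not_lt_zero _)
  | n + 1, done, rest, hn => by
    intro hd t ht
    by_cases h : rest.Nonempty
    · rw [expand_of_nonempty Cov trig f c legs obs M h, mem_mbind] at ht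
      obtain ⟨o, ho, ht⟩ := ht
      have hcard : o.rest.card < n := lt_of_lt_of_le (lt_of_le_of_lt (Finset.card_le_card (run_rest_subset _ _ _ o ho))
        (Finset.card_erase_lt_of_mem (rest.min'_mem h))) (Nat.lt_succ_iff.1 hn)
      -- the run of the pristine observable: `sizeN o · Π_done wt ≤ wt o.g · Π_{o.done} wt`
      have hrun := run_weight_N (trig := trig) (M := M) hN0 hB0 hcV0 hB hBf hBzN hcV hobs hlegs
        (pristine obs (rest.min' h)) (rest.erase (rest.min' h)) done o ho (hobs _) hd
      rw [wt_pristine', one_mul] at hrun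
      -- legs of the set-aside components of the outcome are in `Dir`
      have hdo : ∀ h' ∈ o.done, ∀ w ∈ h'.pend, w ∈ Dir :=
        fun h' hh' => hd h' (Multiset.mem_of_le (run_done_le _ _ _ o ho) hh')
      have hT := sizeN_nonneg hN0 o
      split_ifs at ht with hg
      · rw [Multiset.mem_map] at ht
        obtain ⟨t', ht', rfl⟩ := ht
        have IH := expand_weight_N hN0 hB0 hcV0 hB hBf hBzN hcV hobs hlegs n o.done o.rest hcard hdo t' ht'
        simp only [WTerm.addConst_coef, WTerm.addConst_dirs, WTerm.addConst_consts, WTerm.addConst_groups, oact_coef,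
          oact_dirs, oact_consts, oact_groups, abs_mul, List.map_append, List.prod_append, Multiset.map_cons,
          Multiset.prod_cons]
        have h1 : 0 ≤ |t'.coef| * (t'.dirs.map N).prod :=
          mul_nonneg (abs_nonneg _) (List.prod_nonneg fun x hx => by
            obtain ⟨z, -, rfl⟩ := List.mem_map.1 hx; exact hN0 _)
        calc |o.a| * |t'.coef| * (((o.D.map N).prod) * (t'.dirs.map N).prod) * (done.map (wt B cV)).prod
            = (|t'.coef| * (t'.dirs.map N).prod) * (|o.a| * (o.D.map N).prod * (done.map (wt B cV)).prod) := by ring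
          _ ≤ (|t'.coef| * (t'.dirs.map N).prod) * (wt B cV o.g * (o.done.map (wt B cV)).prod) :=
              mul_le_mul_of_nonneg_left hrun h1
          _ = wt B cV o.g * (|t'.coef| * (t'.dirs.map N).prod * (o.done.map (wt B cV)).prod) := by ring
          _ ≤ wt B cV o.g * ((t'.consts.map (wt B cV)).prod * (t'.groups.map (wt B cV)).prod) :=
              mul_le_mul_of_nonneg_left IH (wt_nonneg' hB0 hcV0 _)
          _ = wt B cV o.g * (t'.consts.map (wt B cV)).prod * (t'.groups.map (wt B cV)).prod := by ring
      · rw [Multiset.mem_map] at ht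
        obtain ⟨t', ht', rfl⟩ := ht
        have hdo' : ∀ h' ∈ o.g ::ₘ o.done, ∀ w ∈ h'.pend, w ∈ Dir := fun h' hh' => by
          rcases Multiset.mem_cons.1 hh' with rfl | hh'
          · -- legs of the outcome's component: from the direction bookkeeping of the run
            intro w hw
            exact run_pend_dir (trig := trig) (M := M) hobs hlegs _ _ _ o ho (hobs _) hd w hw
          · exact hdo h' hh'
        have IH := expand_weight_N hN0 hB0 hcV0 hB hBf hBzN hcV hobs hlegs n _ o.rest hcard hdo' t' ht'
        simp only [oact_coef, oact_dirs, oact_consts, oact_groups, abs_mul, List.map_append, List.prod_append,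
          Multiset.map_cons, Multiset.prod_cons] at IH ⊢
        have h1 : 0 ≤ |t'.coef| * (t'.dirs.map N).prod :=
          mul_nonneg (abs_nonneg _) (List.prod_nonneg fun x hx => by
            obtain ⟨z, -, rfl⟩ := List.mem_map.1 hx; exact hN0 _)
        calc |o.a| * |t'.coef| * (((o.D.map N).prod) * (t'.dirs.map N).prod) * (done.map (wt B cV)).prod
            = (|t'.coef| * (t'.dirs.map N).prod) * (|o.a| * (o.D.map N).prod * (done.map (wt B cV)).prod) := by ring
          _ ≤ (|t'.coef| * (t'.dirs.map N).prod) * (wt B cV o.g * (o.done.map (wt B cV)).prod) :=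
              mul_le_mul_of_nonneg_left hrun h1
          _ = |t'.coef| * (t'.dirs.map N).prod * (wt B cV o.g * (o.done.map (wt B cV)).prod) := rfl
          _ ≤ (t'.consts.map (wt B cV)).prod * (t'.groups.map (wt B cV)).prod := IH
    · rw [expand_of_not_nonempty Cov trig f c legs obs M h, Multiset.mem_singleton] at ht
      subst ht
      simp

/-- **Corollary** (from nothing set aside): `|coef_t| · Π_{z ∈ dirs_t} N z ≤ Π_{X ∈ t.consts} wt X · Π_{X ∈ t.groups} wt X`
for every term `t` of `expand 0 K`.  (`N = ‖·‖_∞`: `BIJ88WalkWeights312.expand_weight_init`.)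
[cite: BalabanImbrieJaffe1988, §5.14 p.312] -/
theorem expand_weight_init_N {N : (S → ℝ) → ℝ} (hN0 : ∀ z, 0 ≤ N z) {Dir : Set (S → ℝ)} {B : P → ℝ} {cV : ι → ℝ}
    (hB0 : ∀ p, 0 ≤ B p) (hcV0 : ∀ m, 0 ≤ cV m)
    (hB : ∀ p, ∀ u ∈ Dir, ∀ w ∈ Dir, |(Cov p *ᵥ u) ⬝ᵥ w| ≤ B p) (hBf : ∀ p, ∀ u ∈ Dir, |(Cov p *ᵥ u) ⬝ᵥ f| ≤ B p)
    (hBzN : ∀ p, ∀ u ∈ Dir, N (Cov p *ᵥ u) ≤ B p) (hcV : ∀ m, |c m| ≤ cV m)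
    (hobs : ∀ j, ∀ w ∈ obs j, w ∈ Dir) (hlegs : ∀ m, ∀ w ∈ legs m, w ∈ Dir) (K : Finset κ) :
    ∀ t ∈ expand Cov trig f c legs obs M 0 K,
      |t.coef| * (t.dirs.map N).prod ≤ (t.consts.map (wt B cV)).prod * (t.groups.map (wt B cV)).prod := by
  intro t ht
  have h := expand_weight_N (trig := trig) (M := M) hN0 hB0 hcV0 hB hBf hBzN hcV hobs hlegs _ 0 K (Nat.lt_succ_self _)
    (fun _ hh => absurd hh (Multiset.notMem_zero _)) t ht
  simpa using h

/-- **Consistency with gen 18**: the instance `N = ‖·‖_∞` of `expand_weight_init_N` is (the statement of)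
`BIJ88WalkWeights312.expand_weight_init`. [cite: BalabanImbrieJaffe1988, §5.14 p.312] -/
theorem expand_weight_init_norm {Dir : Set (S → ℝ)} {B : P → ℝ} {cV : ι → ℝ} (hB0 : ∀ p, 0 ≤ B p)
    (hcV0 : ∀ m, 0 ≤ cV m)
    (hB : ∀ p, ∀ u ∈ Dir, ∀ w ∈ Dir, |(Cov p *ᵥ u) ⬝ᵥ w| ≤ B p) (hBf : ∀ p, ∀ u ∈ Dir, |(Cov p *ᵥ u) ⬝ᵥ f| ≤ B p)
    (hBz : ∀ p, ∀ u ∈ Dir, ‖Cov p *ᵥ u‖ ≤ B p) (hcV : ∀ m, |c m| ≤ cV m)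
    (hobs : ∀ j, ∀ w ∈ obs j, w ∈ Dir) (hlegs : ∀ m, ∀ w ∈ legs m, w ∈ Dir) (K : Finset κ) :
    ∀ t ∈ expand Cov trig f c legs obs M 0 K,
      |t.coef| * (t.dirs.map fun z => ‖z‖).prod ≤ (t.consts.map (wt B cV)).prod * (t.groups.map (wt B cV)).prod :=
  expand_weight_init_N (N := fun z => ‖z‖) (fun z => norm_nonneg z) hB0 hcV0 hB hBf hBz hcV hobs hlegs K

end Expand

end Literature.MathematicalPhysics.QuantumFieldTheory.BalabanImbrieJaffe1984to88.BIJ88WalkWeightsN312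

end
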